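import Mathlib.Combinatorics.Configuration
import Mathlib.LinearAlgebra.Matrix.SchurComplement
import Mathlib.NumberTheory.SumTwoSquares
import Mathlib.NumberTheory.SumFourSquares
import Mathlib.Data.Rat.Lemmas
import Mathlib.Tactic.IntervalCases
import HarnessLib

/-!
# Symmetric `(v,k,λ)` designs: Schützenberger's theorem and the Bruck–Ryser–Chowla theorem

Trunk Literature/Combinatorics (item wi-34995, wanted by route PneNP/BruckRyserSos, whose
sum-of-squares rungs live on the *design equations* `AAᵀ = AᵀA = (k-λ)I + λJ` at parameters where
no design exists).

* `SymmetricDesign v k lam` — a symmetric `(v,k,λ)` design **presented by its incidence matrix**: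
  a `0/1` matrix `A` of size `v × v` over `ℤ` (rows = points, columns = blocks) with
  `AAᵀ = AᵀA = (k-λ)I + λJ` (Lander 1983, §1.1: the six axioms "v points, v blocks, every block
  has k points, every point is on k blocks, two blocks meet in λ points, two points lie on λ
  common blocks" in matrix form; the row/column-sum equations `AJ = JA = kJ` are the diagonal
  entries and are derived: `row_sum`, `col_sum`). Lander's non-degeneracy proviso `k > λ` is NOT
  imposed (the theorems below do not need it). API: the basic relation `λ(v-1) = k(k-1)`
  (`param_eq`, Lander Prop. 1.1) and `(det A)² = k²(k-λ)^(v-1)` (`det_incidence_sq`, Lander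
  Prop. 1.2), through the determinant evaluation `det(aI + bJ) = a^(v-1)(a + vb)`
  (`det_smul_one_add_smul_allOnes`).
* `SymmetricDesign.isSquare_sub_of_even` — **Schützenberger's theorem** (1949; Lander Thm. 1.3;
  Chowla–Ryser 1950 Thm. 3), PROVED: if a symmetric `(v,k,λ)` design exists and `v` is even
  (and `v > 0`), then `k - λ` is a perfect square; as non-existence statements `isEmpty_of_even`
  and the worked instance `isEmpty_22_7_2` (no symmetric `(22,7,2)` design).
* `BruckRyserChowla` — the **Bruck–Ryser–Chowla theorem** as a NAMED FACT (Lander Thm. 2.1;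
  Bruck–Ryser 1949 for `λ = 1`, Chowla–Ryser 1950 Thms. 4–5 in general): if a symmetric
  `(v,k,λ)` design with `k > λ` exists and `v` is odd, then `(k-λ)X² + (-1)^((v-1)/2) λ Y² = Z²`
  has a solution in integers not all zero. **PROVED** at the end of this file
  (`BruckRyserChowla_holds`), following Ryser 1963, Ch. 8, Thm. 3.1: the incidence matrix gives
  the rational congruence `(k-λ)I + λJ ≅ I` (`SymmetricDesign.sum_sq_incidence_form`), Lagrange's
  four-square theorem (Mathlib's `Nat.sum_four_squares`) and the quaternion matrix `H` give
  `(k-λ)I_m ≅ I_m` for `4 ∣ m` (`BruckRyserChowlaProof.exists_matrix_of_four_dvd`), and Ryser's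
  free-variable descent `x_i = ± y_i` on the resulting identity of rational quadratic forms
  (`BruckRyserChowlaProof.descent`, cases `v ≡ 1, 3 (mod 4)`:
  `BruckRyserChowlaProof.exists_rat_of_forms_one/three`) produces a rational point; clearing
  denominators finishes. The degenerate case `k ≤ λ` is proved by hand
  (`SymmetricDesign.bruckRyserChowla_of_le`), so `SymmetricDesign.bruckRyserChowla` gives the
  conclusion for every `SymmetricDesign` from the fact, and
  `SymmetricDesign.exists_bruckRyserChowla` / `exists_bruckRyserChowla_of_pos` unconditionally
  (Lander's remark: for `v` even `(1, 0, √n)` is a solution).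
* `SymmetricDesign.ofProjectivePlane` — the incidence matrix of a finite projective plane of
  order `n` (Mathlib's `Configuration.ProjectivePlane`) is a symmetric `(n²+n+1, n+1, 1)` design
  (Bruck–Ryser 1949, Thm. 2), PROVED; hence (`order_eq_sq_add_sq_of_bruckRyserChowla`, PROVED
  from the named fact): **if a projective plane of order `n ≡ 1, 2 (mod 4)` exists then `n` is a
  sum of two squares** (Bruck–Ryser 1949, Thm. 1; Lander 1983, §2.1 p. 43), so that, given the
  fact, there is no projective plane of order `6` (`order_ne_six_of_bruckRyserChowla`; likewise
  14, 21, 22, 30, 33, …); unconditionally, with the fact proved: `order_eq_sq_add_sq`,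
  **`order_ne_six`** (there is no projective plane of order 6), `order_ne_fourteen`,
  `order_ne_twentyone`, `order_ne_twentytwo`.

What is NOT here: Lam–Thiel–Swiercz 1989 (no plane of order 10; a computer search, not a
hypothesis of any filed item) is deliberately not vendored; Ryser's theorem that `AAᵀ = (k-λ)I + λJ`
alone already forces `AᵀA = AAᵀ` (Chowla–Ryser 1950, Thm. 1) is not needed and not stated — both
Gram identities are fields of the structure, matching the design system `D(v,k,λ)` of
`Literature.Computability.MetaComplexity.SumOfSquaresSystems` (same cell convention: row = point,
column = block).

## References

* E. S. Lander, *Symmetric Designs: An Algebraic Approach*, LMS Lecture Note Series 74, CUP 1983,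
  doi:10.1017/cbo9780511662164: §1.1 (definition, incidence-matrix equations, Prop. 1.1,
  Prop. 1.2, Thm. 1.3), §2.1 (Thm. 2.1 and the application to projective planes). [Lander1983]
* M. P. Schützenberger, *A non-existence theorem for an infinite family of symmetrical block
  designs*, Ann. Eugenics 14 (1949) 286–287. [Schutzenberger1949]
* R. H. Bruck, H. J. Ryser, *The nonexistence of certain finite projective planes*, Canad. J.
  Math. 1 (1949) 88–93, doi:10.4153/cjm-1949-009-2: Thm. 1 (planes), Thm. 2 (incidence matrix).
  [BruckRyser1949]
* S. Chowla, H. J. Ryser, *Combinatorial problems*, Canad. J. Math. 2 (1950) 93–99,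
  doi:10.4153/cjm-1950-009-8: Thm. 3 (`v` even), Thms. 4–5 (`v ≡ 1, 3 (mod 4)`). [ChowlaRyser1950]
* H. J. Ryser, *Combinatorial Mathematics*, Carus Mathematical Monographs 14, MAA 1963,
  doi:10.5948/upo9781614440147: Ch. 8 §3, (3.11)–(3.16) (congruence of `mI_n` and `I_n` over `ℚ`
  for `n ≡ 0 (mod 4)` via Lagrange's four-square theorem and the matrix `H`) and Thm. 3.1 with
  its proof (3.19)–(3.35) (the free-variable descent) — the proof formalized here. [Ryser1963]
-/

namespace Literature.Combinatorics.Designs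

open Matrix Finset

/-! ### The all-ones matrix and the determinant of `aI + bJ` -/

/-- The all-ones `v × v` integer matrix `J`. [folklore] -/
def allOnes (v : ℕ) : Matrix (Fin v) (Fin v) ℤ := Matrix.of fun _ _ => 1

/-- Entries of `J` are `1`. [folklore] -/
@[simp] theorem allOnes_apply (v : ℕ) (i j : Fin v) : allOnes v i j = 1 := rfl

/-- Over a field, `det (aI + bJ) = a^(v-1) (a + v b)` for the `v × v` all-ones matrix `J`, `v ≥ 1`
(the matrix determinant lemma for `a ≠ 0`; two equal rows for `a = 0`). (Lander 1983, §1.1: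
"the `v × v` matrix `aI + bJ` has determinant `(a+vb)a^(v-1)`".) [cite: Lander1983, §1.1] -/
theorem det_smul_one_add_smul_of_one {K : Type*} [Field K] {v : ℕ} (hv : 0 < v) (a b : K) :
    (a • (1 : Matrix (Fin v) (Fin v) K) + b • Matrix.of (fun _ _ => (1 : K))).det =
      a ^ (v - 1) * (a + v * b) := by
  obtain ⟨m, rfl⟩ : ∃ m, v = m + 1 := ⟨v - 1, (Nat.succ_pred_eq_of_pos hv).symm⟩
  rw [Nat.add_sub_cancel]
  rcases eq_or_ne a 0 with rfl | ha
  · rw [zero_smul, zero_add, zero_add]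
    cases m with
    | zero => simp [Matrix.det_unique]
    | succ m =>
      rw [Matrix.det_zero_of_row_eq (i := (0 : Fin (m + 2))) (j := 1) (by simp) (by ext j; simp)]
      simp
  · have hM : a • (1 : Matrix (Fin (m + 1)) (Fin (m + 1)) K) + b • Matrix.of (fun _ _ => (1 : K)) =
        a • ((1 : Matrix (Fin (m + 1)) (Fin (m + 1)) K) +
          replicateCol Unit (fun _ => b / a) * replicateRow Unit (fun _ => (1 : K))) := by
      ext i j
      simp only [Matrix.add_apply, Matrix.smul_apply, of_apply, smul_eq_mul, mul_one,
        Matrix.mul_apply, replicateCol_apply, replicateRow_apply, Finset.sum_const,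
        Finset.card_univ, Fintype.card_unit, one_smul, mul_add]
      rw [mul_div_cancel₀ b ha]
    rw [hM, det_smul, det_one_add_replicateCol_mul_replicateRow, Fintype.card_fin]
    simp only [dotProduct, one_mul, Finset.sum_const, Finset.card_univ, Fintype.card_fin,
      nsmul_eq_mul]
    rw [pow_succ]
    field_simp

/-- Over `ℤ`: `det (aI + bJ) = a^(v-1) (a + v b)` for `v ≥ 1`. (Lander 1983, §1.1.)
[cite: Lander1983, §1.1] -/
theorem det_smul_one_add_smul_allOnes {v : ℕ} (hv : 0 < v) (a b : ℤ) :
    (a • (1 : Matrix (Fin v) (Fin v) ℤ) + b • allOnes v).det = a ^ (v - 1) * (a + v * b) := by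
  apply Int.cast_injective (α := ℚ)
  rw [Int.cast_det]
  have hmap : (a • (1 : Matrix (Fin v) (Fin v) ℤ) + b • allOnes v).map (fun x : ℤ => (x : ℚ)) =
      (a : ℚ) • (1 : Matrix (Fin v) (Fin v) ℚ) + (b : ℚ) • Matrix.of (fun _ _ => (1 : ℚ)) := by
    ext i j
    simp only [map_apply, Matrix.add_apply, Matrix.smul_apply, allOnes_apply, of_apply, smul_eq_mul,
      mul_one, Int.cast_add, Int.cast_mul, Matrix.one_apply]
    split_ifs <;> simp
  rw [hmap, det_smul_one_add_smul_of_one hv]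
  push_cast
  ring

/-! ### Symmetric designs by their incidence matrices -/

/-- A **symmetric `(v,k,λ)` design**, presented by its incidence matrix: a `v × v` matrix `A`
with entries in `{0,1}` (rows indexed by the `v` points, columns by the `v` blocks, `A p B = 1`
iff point `p` is on block `B`) such that `AAᵀ = AᵀA = (k-λ)I + λJ` — i.e. every point is on `k`
blocks, every block has `k` points, two distinct points are on `λ` common blocks and two
distinct blocks share `λ` points. This is the incidence-matrix form of the six axioms of
Lander 1983, §1.1 (who indexes rows by blocks; immaterial here since both Gram identities are
required); Lander's proviso `k > λ` excluding degenerate designs is NOT imposed.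
[cite: Lander1983, §1.1] -/
structure SymmetricDesign (v k lam : ℕ) where
  /-- The incidence matrix: rows = points, columns = blocks. -/
  incidence : Matrix (Fin v) (Fin v) ℤ
  /-- Entries are `0` or `1`. -/
  incidence_apply (p B : Fin v) : incidence p B = 0 ∨ incidence p B = 1
  /-- `AAᵀ = (k-λ)I + λJ`: every point is on `k` blocks, two points on `λ` common blocks. -/
  incidence_mul_transpose :
    incidence * incidenceᵀ =
      ((k : ℤ) - lam) • (1 : Matrix (Fin v) (Fin v) ℤ) + (lam : ℤ) • allOnes v
  /-- `AᵀA = (k-λ)I + λJ`: every block has `k` points, two blocks share `λ` points. -/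
  transpose_mul_incidence :
    incidenceᵀ * incidence =
      ((k : ℤ) - lam) • (1 : Matrix (Fin v) (Fin v) ℤ) + (lam : ℤ) • allOnes v

namespace SymmetricDesign

variable {v k lam : ℕ}

/-- `0/1` entries are idempotent. [folklore] -/
theorem incidence_mul_self (D : SymmetricDesign v k lam) (p B : Fin v) :
    D.incidence p B * D.incidence p B = D.incidence p B := by
  rcases D.incidence_apply p B with h | h <;> simp [h]

/-- Entries of `AAᵀ`: `∑_B A p B · A p' B` is `k` on the diagonal and `λ` off it.
(Lander 1983, §1.1.) [cite: Lander1983, §1.1] -/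
theorem sum_incidence_mul_incidence (D : SymmetricDesign v k lam) (p p' : Fin v) :
    ∑ B, D.incidence p B * D.incidence p' B = if p = p' then (k : ℤ) else (lam : ℤ) := by
  have h := congrFun (congrFun D.incidence_mul_transpose p) p'
  simp only [mul_apply, transpose_apply, Matrix.add_apply, Matrix.smul_apply, Matrix.one_apply,
    allOnes_apply, smul_eq_mul, mul_one, mul_ite, mul_zero] at h
  rw [h]
  split_ifs <;> ring

/-- Entries of `AᵀA`: `∑_p A p B · A p B'` is `k` on the diagonal and `λ` off it.
(Lander 1983, §1.1.) [cite: Lander1983, §1.1] -/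
theorem sum_incidence_mul_incidence' (D : SymmetricDesign v k lam) (B B' : Fin v) :
    ∑ p, D.incidence p B * D.incidence p B' = if B = B' then (k : ℤ) else (lam : ℤ) := by
  have h := congrFun (congrFun D.transpose_mul_incidence B) B'
  simp only [mul_apply, transpose_apply, Matrix.add_apply, Matrix.smul_apply, Matrix.one_apply,
    allOnes_apply, smul_eq_mul, mul_one, mul_ite, mul_zero] at h
  rw [h]
  split_ifs <;> ring

/-- Every point is on `k` blocks: the row sums of `A` are `k` (`AJ = kJ`). (Lander 1983, §1.1,
axiom (4).) [cite: Lander1983, §1.1] -/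
theorem row_sum (D : SymmetricDesign v k lam) (p : Fin v) : ∑ B, D.incidence p B = k := by
  calc ∑ B, D.incidence p B = ∑ B, D.incidence p B * D.incidence p B :=
        Finset.sum_congr rfl fun B _ => (D.incidence_mul_self p B).symm
    _ = k := by simpa using D.sum_incidence_mul_incidence p p

/-- Every block has `k` points: the column sums of `A` are `k` (`JA = kJ`). (Lander 1983, §1.1,
axiom (3).) [cite: Lander1983, §1.1] -/
theorem col_sum (D : SymmetricDesign v k lam) (B : Fin v) : ∑ p, D.incidence p B = k := by
  calc ∑ p, D.incidence p B = ∑ p, D.incidence p B * D.incidence p B :=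
        Finset.sum_congr rfl fun p _ => (D.incidence_mul_self p B).symm
    _ = k := by simpa using D.sum_incidence_mul_incidence' B B

/-- **The basic parameter relation** `k² = (k - λ) + vλ`, i.e. `λ(v-1) = k(k-1)`, of a symmetric
design on `v ≥ 1` points (count the flags `(p', B)` with `B` through a fixed point `p₀` in two
ways). (Lander 1983, Prop. 1.1 (1).) [cite: Lander1983, Prop 1.1] -/
theorem param_eq (D : SymmetricDesign v k lam) (hv : 0 < v) :
    (k : ℤ) ^ 2 = (k : ℤ) - lam + v * lam := by
  set p₀ : Fin v := ⟨0, hv⟩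
  have h1 : ∑ p', ∑ B, D.incidence p₀ B * D.incidence p' B = (k : ℤ) ^ 2 := by
    rw [Finset.sum_comm]
    simp_rw [← Finset.mul_sum, D.col_sum, ← Finset.sum_mul, D.row_sum]
    ring
  have h2 : ∑ p', ∑ B, D.incidence p₀ B * D.incidence p' B = (k : ℤ) - lam + v * lam := by
    simp_rw [D.sum_incidence_mul_incidence p₀]
    have hsplit : ∀ p' : Fin v, (if p₀ = p' then (k : ℤ) else (lam : ℤ)) =
        (lam : ℤ) + if p₀ = p' then (k : ℤ) - lam else 0 := by
      intro p'
      split_ifs <;> ring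
    simp_rw [hsplit]
    rw [Finset.sum_add_distrib, Finset.sum_const, Finset.card_univ, Fintype.card_fin,
      Finset.sum_ite_eq, if_pos (Finset.mem_univ _), nsmul_eq_mul]
    ring
  rw [← h1, h2]

/-- The basic relation in its usual form `λ(v-1) = k(k-1)`. (Lander 1983, Prop. 1.1 (1).)
[cite: Lander1983, Prop 1.1] -/
theorem lam_mul_pred_eq (D : SymmetricDesign v k lam) (hv : 0 < v) :
    (lam : ℤ) * (v - 1) = k * (k - 1) := by
  have h := D.param_eq hv
  linear_combination -h

/-- Off-diagonal inner products are at most the row sum: `λ ≤ k` as soon as `v ≥ 2`. [folklore] -/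
theorem lam_le (D : SymmetricDesign v k lam) (hv : 1 < v) : lam ≤ k := by
  have h := D.sum_incidence_mul_incidence ⟨0, by omega⟩ ⟨1, hv⟩
  rw [if_neg (by simp [Fin.ext_iff])] at h
  have hle : ∑ B, D.incidence ⟨0, by omega⟩ B * D.incidence ⟨1, hv⟩ B ≤
      ∑ B, D.incidence ⟨0, by omega⟩ B := by
    refine Finset.sum_le_sum fun B _ => ?_
    rcases D.incidence_apply ⟨0, by omega⟩ B with h₀ | h₀ <;>
      rcases D.incidence_apply ⟨1, hv⟩ B with h₁ | h₁ <;> simp [h₀, h₁]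
  rw [h, D.row_sum] at hle
  exact_mod_cast hle

/-- **`(det A)² = k² (k-λ)^(v-1)`** for the incidence matrix of a symmetric `(v,k,λ)` design on
`v ≥ 1` points (`det(AAᵀ) = det((k-λ)I + λJ) = (k-λ)^(v-1)(k - λ + vλ)` and `k - λ + vλ = k²`).
(Lander 1983, Prop. 1.2: `|det A| = k n^((v-1)/2)`; Chowla–Ryser 1950, proof of Thm. 3.)
[cite: Lander1983, Prop 1.2] -/
theorem det_incidence_sq (D : SymmetricDesign v k lam) (hv : 0 < v) :
    D.incidence.det ^ 2 = (k : ℤ) ^ 2 * ((k : ℤ) - lam) ^ (v - 1) := by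
  have h : D.incidence.det ^ 2 = (D.incidence * D.incidenceᵀ).det := by
    rw [det_mul, det_transpose, sq]
  rw [h, D.incidence_mul_transpose, det_smul_one_add_smul_allOnes hv, D.param_eq hv]
  ring

/-- **Schützenberger's theorem.** If a symmetric `(v,k,λ)` design exists and `v` is even
(`v > 0`), then its order `n = k - λ` is a perfect square: `(det A)² = k² n^(v-1)` with `v - 1`
odd forces `n` to be a rational, hence integral, square. (Schützenberger 1949; Lander 1983,
Thm. 1.3; Chowla–Ryser 1950, Thm. 3.) [cite: Lander1983, Thm 1.3] -/
theorem isSquare_sub_of_even (D : SymmetricDesign v k lam) (hv : Even v) (hpos : 0 < v) :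
    IsSquare ((k : ℤ) - lam) := by
  set n : ℤ := (k : ℤ) - lam with hn
  rcases eq_or_ne n 0 with h0 | h0
  · rw [h0]
    exact ⟨0, by simp⟩
  obtain ⟨m, hm⟩ : ∃ m, v = 2 * m + 2 := by
    obtain ⟨t, ht⟩ := hv
    exact ⟨t - 1, by omega⟩
  have hparam := D.param_eq hpos
  have hk : (k : ℤ) ≠ 0 := by
    intro hk0
    rw [hk0] at hparam
    have hmul : ((v : ℤ) - 1) * lam = 0 := by linear_combination -hparam
    rcases mul_eq_zero.mp hmul with h1 | h1
    · omega
    · exact h0 (by rw [hn, hk0, h1, sub_zero])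
  have hdet : D.incidence.det ^ 2 = ((k : ℤ) * n ^ m) ^ 2 * n := by
    rw [D.det_incidence_sq hpos, hm, show 2 * m + 2 - 1 = 2 * m + 1 by omega]
    ring
  set c : ℤ := (k : ℤ) * n ^ m with hc_def
  have hc : c ≠ 0 := mul_ne_zero hk (pow_ne_zero _ h0)
  have hq : IsSquare ((n : ℤ) : ℚ) := by
    refine ⟨(D.incidence.det : ℚ) / c, ?_⟩
    have hc' : (c : ℚ) ≠ 0 := by exact_mod_cast hc
    have hdet' : ((D.incidence.det : ℤ) : ℚ) ^ 2 = (c : ℚ) ^ 2 * (n : ℚ) := by exact_mod_cast hdet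
    field_simp
    linear_combination -hdet'
  exact Rat.isSquare_intCast_iff.mp hq

/-- Schützenberger's theorem with the order as a natural number: for `v ≥ 2` even, `λ ≤ k` and
`k - λ : ℕ` is a perfect square. (Lander 1983, Thm. 1.3.) [cite: Lander1983, Thm 1.3] -/
theorem isSquare_sub_of_even' (D : SymmetricDesign v k lam) (hv : Even v) (hpos : 0 < v) :
    IsSquare (k - lam) := by
  have h2 : 1 < v := by
    obtain ⟨t, ht⟩ := hv
    omega
  have hle := D.lam_le h2
  obtain ⟨r, hr⟩ := D.isSquare_sub_of_even hv hpos
  refine ⟨r.natAbs, ?_⟩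
  apply Int.natCast_inj.mp
  push_cast [hle]
  rw [hr, ← sq, ← sq, sq_abs]

/-- Schützenberger's theorem as a non-existence statement: for `v ≥ 2` even and `k - λ` not a
perfect square there is no symmetric `(v,k,λ)` design. (Lander 1983, Thm. 1.3; Chowla–Ryser 1950,
Thm. 3.) [cite: Lander1983, Thm 1.3] -/
theorem isEmpty_of_even (hv : Even v) (hpos : 0 < v) (h : ¬ IsSquare ((k : ℤ) - lam)) :
    IsEmpty (SymmetricDesign v k lam) :=
  ⟨fun D => h (D.isSquare_sub_of_even hv hpos)⟩

/-- Example (the first case of the "determinant tier" of route PneNP/BruckRyserSos): there is no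
symmetric `(22,7,2)` design — `v = 22` is even and `k - λ = 5` is not a square.
(Lander 1983, Thm. 1.3.) [cite: Lander1983, Thm 1.3] -/
theorem isEmpty_22_7_2 : IsEmpty (SymmetricDesign 22 7 2) := by
  refine isEmpty_of_even (by decide) (by norm_num) ?_
  rintro ⟨r, hr⟩
  have h5 : r * r = 5 := by rw [← hr]; norm_num
  have h1 : r ≤ 2 := by nlinarith
  have h2 : -2 ≤ r := by nlinarith
  interval_cases r <;> omega

end SymmetricDesign

/-! ### The Bruck–Ryser–Chowla theorem (named fact) -/

/-- **The Bruck–Ryser–Chowla theorem** (named fact; proved below as `BruckRyserChowla_holds`).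
Suppose a symmetric `(v,k,λ)` design with `k > λ` exists (an incidence matrix as in
`SymmetricDesign v k lam`; `k > λ` is Lander's standing non-degeneracy assumption, §1.1). If `v`
is odd, then the equation `n X² + (-1)^((v-1)/2) λ Y² = Z²`, `n = k - λ`, has a solution in
integers `X, Y, Z` not all zero.
(Lander 1983, Thm. 2.1, p. 42; proved for `λ = 1` by Bruck–Ryser 1949 and in general by
Chowla–Ryser 1950, Thms. 4–5, via Lagrange's four-square theorem and rational quadratic forms.)
The degenerate case `k ≤ λ` is settled by hand in `SymmetricDesign.bruckRyserChowla_of_le`, and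
`SymmetricDesign.bruckRyserChowla` combines the two. [cite: Lander1983, Thm 2.1] -/
def BruckRyserChowla : Prop :=
  ∀ (v k lam : ℕ), SymmetricDesign v k lam → lam < k → Odd v →
    ∃ x y z : ℤ, (x ≠ 0 ∨ y ≠ 0 ∨ z ≠ 0) ∧
      ((k : ℤ) - lam) * x ^ 2 + (-1) ^ ((v - 1) / 2) * lam * y ^ 2 = z ^ 2

namespace SymmetricDesign

variable {v k lam : ℕ}

/-- The degenerate case `k ≤ λ` of the Bruck–Ryser–Chowla equation, excluded by Lander's
standing assumption `k > λ`, holds trivially: for `v ≥ 2` one has `λ ≤ k`, so `k = λ`, `n = 0` and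
`(X,Y,Z) = (1,0,0)` is a solution; for `v = 1` the `1 × 1` incidence matrix gives `k ∈ {0,1}` and
`(1,1,k)` is a solution. [folklore] -/
theorem bruckRyserChowla_of_le (D : SymmetricDesign v k lam) (hkl : k ≤ lam) (hodd : Odd v) :
    ∃ x y z : ℤ, (x ≠ 0 ∨ y ≠ 0 ∨ z ≠ 0) ∧
      ((k : ℤ) - lam) * x ^ 2 + (-1) ^ ((v - 1) / 2) * lam * y ^ 2 = z ^ 2 := by
  rcases Nat.lt_or_ge 1 v with h2 | h2
  · have hk : k = lam := le_antisymm hkl (D.lam_le h2)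
    exact ⟨1, 0, 0, by simp, by simp [hk]⟩
  · obtain rfl : v = 1 := by
      obtain ⟨t, ht⟩ := hodd
      omega
    have hrow := D.row_sum 0
    rw [Fin.sum_univ_one] at hrow
    have hk01 : (k : ℤ) = 0 ∨ (k : ℤ) = 1 := hrow ▸ D.incidence_apply 0 0
    refine ⟨1, 1, k, by simp, ?_⟩
    have hk2 : (k : ℤ) ^ 2 = k := by rcases hk01 with h | h <;> rw [h] <;> norm_num
    rw [hk2]
    norm_num

/-- **Bruck–Ryser–Chowla for every `SymmetricDesign`** (from the named fact `BruckRyserChowla`,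
the degenerate case `k ≤ λ` being `bruckRyserChowla_of_le`): if `v` is odd then
`(k-λ)X² + (-1)^((v-1)/2) λ Y² = Z²` has an integral solution `(X,Y,Z) ≠ (0,0,0)`.
(Lander 1983, Thm. 2.1.) [cite: Lander1983, Thm 2.1] -/
theorem bruckRyserChowla (hBRC : BruckRyserChowla) (D : SymmetricDesign v k lam) (hodd : Odd v) :
    ∃ x y z : ℤ, (x ≠ 0 ∨ y ≠ 0 ∨ z ≠ 0) ∧
      ((k : ℤ) - lam) * x ^ 2 + (-1) ^ ((v - 1) / 2) * lam * y ^ 2 = z ^ 2 := by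
  rcases Nat.lt_or_ge lam k with h | h
  · exact hBRC v k lam D h hodd
  · exact D.bruckRyserChowla_of_le h hodd

end SymmetricDesign

/-! ### Projective planes are symmetric `(n²+n+1, n+1, 1)` designs -/

section ProjectivePlane

open Configuration

variable (P L : Type*) [Membership P L] [Fintype P] [Fintype L]
  [Configuration.ProjectivePlane P L]

/-- An enumeration of the `n² + n + 1` points of a finite projective plane of order `n`.
[folklore] -/
noncomputable def pointEnum :
    Fin (ProjectivePlane.order P L ^ 2 + ProjectivePlane.order P L + 1) ≃ P :=
  (Fintype.equivFinOfCardEq (ProjectivePlane.card_points P L)).symm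

/-- An enumeration of the `n² + n + 1` lines of a finite projective plane of order `n`.
[folklore] -/
noncomputable def lineEnum :
    Fin (ProjectivePlane.order P L ^ 2 + ProjectivePlane.order P L + 1) ≃ L :=
  (Fintype.equivFinOfCardEq (ProjectivePlane.card_lines P L)).symm

open scoped Classical in
/-- The point–line incidence matrix of a finite projective plane (entry `1` iff the `i`-th point
lies on the `j`-th line). (Bruck–Ryser 1949, §2.) [cite: BruckRyser1949, Thm 2] -/
noncomputable def planeIncidence :
    Matrix (Fin (ProjectivePlane.order P L ^ 2 + ProjectivePlane.order P L + 1))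
      (Fin (ProjectivePlane.order P L ^ 2 + ProjectivePlane.order P L + 1)) ℤ :=
  Matrix.of fun i j => if pointEnum P L i ∈ lineEnum P L j then 1 else 0

/-- Counting with indicator products: `∑_b [p b]·[q b] = #{b | p b ∧ q b}`. [folklore] -/
theorem sum_ite_mul_ite {β : Type*} [Fintype β] (p q : β → Prop) [DecidablePred p]
    [DecidablePred q] :
    ∑ b, ((if p b then (1 : ℤ) else 0) * if q b then (1 : ℤ) else 0) =
      (Nat.card {b // p b ∧ q b} : ℤ) := by
  rw [Nat.card_eq_fintype_card, Fintype.card_subtype, Finset.natCast_card_filter]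
  refine Finset.sum_congr rfl fun b _ => ?_
  by_cases hp : p b <;> by_cases hq : q b <;> simp [hp, hq]

variable {P L} in
omit [Fintype P] [Fintype L] in
/-- In a projective plane two distinct points lie on exactly one line. (Bruck–Ryser 1949, §1,
postulate (P1).) [cite: BruckRyser1949, §1] -/
theorem natCard_lines_through {p p' : P} (h : p ≠ p') :
    Nat.card {l : L // p ∈ l ∧ p' ∈ l} = 1 := by
  have hu := Configuration.HasLines.existsUnique_line P L p p' h
  obtain ⟨l₀, hl₀⟩ := hu.exists
  rw [Nat.card_eq_one_iff_unique]
  exact ⟨⟨fun a b => Subtype.ext (hu.unique a.2 b.2)⟩, ⟨⟨l₀, hl₀⟩⟩⟩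

/-- In a projective plane of order `n` every point is on `n + 1` lines. (Bruck–Ryser 1949, §1.)
[cite: BruckRyser1949, §1] -/
theorem natCard_lines_through_self (p : P) :
    Nat.card {l : L // p ∈ l ∧ p ∈ l} = ProjectivePlane.order P L + 1 := by
  rw [← ProjectivePlane.lineCount_eq L p, Configuration.lineCount]
  exact Nat.card_congr (Equiv.subtypeEquivRight fun l => and_self_iff)

variable {P L} in
omit [Fintype P] [Fintype L] in
/-- Dually, two distinct lines meet in exactly one point. (Bruck–Ryser 1949, §1, postulate (P2).)
[cite: BruckRyser1949, §1] -/
theorem natCard_points_on {l l' : L} (h : l ≠ l') :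
    Nat.card {p : P // p ∈ l ∧ p ∈ l'} = 1 := by
  have hu := Configuration.HasPoints.existsUnique_point P L l l' h
  obtain ⟨p₀, hp₀⟩ := hu.exists
  rw [Nat.card_eq_one_iff_unique]
  exact ⟨⟨fun a b => Subtype.ext (hu.unique a.2 b.2)⟩, ⟨⟨p₀, hp₀⟩⟩⟩

/-- In a projective plane of order `n` every line has `n + 1` points. (Bruck–Ryser 1949, §1.)
[cite: BruckRyser1949, §1] -/
theorem natCard_points_on_self (l : L) :
    Nat.card {p : P // p ∈ l ∧ p ∈ l} = ProjectivePlane.order P L + 1 := by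
  rw [← ProjectivePlane.pointCount_eq P l, Configuration.pointCount]
  exact Nat.card_congr (Equiv.subtypeEquivRight fun p => and_self_iff)

/-- Entries of `AAᵀ` for the plane incidence matrix: the number of lines through the `i`-th and
the `i'`-th point. [folklore] -/
theorem planeIncidence_mul_transpose_apply
    (i i' : Fin (ProjectivePlane.order P L ^ 2 + ProjectivePlane.order P L + 1)) :
    (planeIncidence P L * (planeIncidence P L)ᵀ) i i' =
      Nat.card {l : L // pointEnum P L i ∈ l ∧ pointEnum P L i' ∈ l} := by
  classical
  rw [← sum_ite_mul_ite]
  simp only [mul_apply, transpose_apply, planeIncidence, of_apply]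
  exact Fintype.sum_equiv (lineEnum P L) _ _ fun j => rfl

/-- Entries of `AᵀA` for the plane incidence matrix: the number of points on the `j`-th and the
`j'`-th line. [folklore] -/
theorem planeIncidence_transpose_mul_apply
    (j j' : Fin (ProjectivePlane.order P L ^ 2 + ProjectivePlane.order P L + 1)) :
    ((planeIncidence P L)ᵀ * planeIncidence P L) j j' =
      Nat.card {p : P // p ∈ lineEnum P L j ∧ p ∈ lineEnum P L j'} := by
  classical
  rw [← sum_ite_mul_ite]
  simp only [mul_apply, transpose_apply, planeIncidence, of_apply]
  exact Fintype.sum_equiv (pointEnum P L) _ _ fun i => rfl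

/-- **A finite projective plane of order `n` is a symmetric `(n² + n + 1, n + 1, 1)` design**: its
point–line incidence matrix `A` satisfies `AAᵀ = AᵀA = nI + J` (every point is on `n + 1` lines,
every line has `n + 1` points, two points lie on exactly one line, two lines meet in exactly one
point). (Bruck–Ryser 1949, Thm. 2; Lander 1983, §1.3.) [cite: BruckRyser1949, Thm 2] -/
noncomputable def SymmetricDesign.ofProjectivePlane :
    SymmetricDesign (ProjectivePlane.order P L ^ 2 + ProjectivePlane.order P L + 1)
      (ProjectivePlane.order P L + 1) 1 where
  incidence := planeIncidence P L
  incidence_apply i j := by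
    classical
    by_cases h : pointEnum P L i ∈ lineEnum P L j <;> simp [planeIncidence, h]
  incidence_mul_transpose := by
    ext i i'
    rw [planeIncidence_mul_transpose_apply]
    simp only [Matrix.add_apply, Matrix.smul_apply, Matrix.one_apply, allOnes_apply, smul_eq_mul,
      mul_one]
    by_cases h : i = i'
    · subst h
      rw [natCard_lines_through_self, if_pos rfl]
      push_cast
      ring
    · rw [natCard_lines_through ((pointEnum P L).injective.ne h), if_neg h]
      push_cast
      ring
  transpose_mul_incidence := by
    ext j j'
    rw [planeIncidence_transpose_mul_apply]
    simp only [Matrix.add_apply, Matrix.smul_apply, Matrix.one_apply, allOnes_apply, smul_eq_mul,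
      mul_one]
    by_cases h : j = j'
    · subst h
      rw [natCard_points_on_self, if_pos rfl]
      push_cast
      ring
    · rw [natCard_points_on ((lineEnum P L).injective.ne h), if_neg h]
      push_cast
      ring

/-! ### Bruck–Ryser for projective planes, from the named fact -/

/-- The sign in the Bruck–Ryser–Chowla equation of a projective plane of order
`n ≡ 1, 2 (mod 4)`: `v = n² + n + 1`, `(v-1)/2 = n(n+1)/2` is odd. [folklore] -/
theorem neg_one_pow_planes {n : ℕ} (h4 : n % 4 = 1 ∨ n % 4 = 2) :
    (-1 : ℤ) ^ ((n ^ 2 + n + 1 - 1) / 2) = -1 := by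
  rw [Nat.add_sub_cancel]
  apply Odd.neg_one_pow
  rcases h4 with h | h
  · obtain ⟨m, rfl⟩ : ∃ m, n = 4 * m + 1 := ⟨n / 4, by omega⟩
    have : (4 * m + 1) ^ 2 + (4 * m + 1) = 2 * ((4 * m + 1) * (2 * m + 1)) := by ring
    rw [this, Nat.mul_div_cancel_left _ (by norm_num)]
    exact Odd.mul ⟨2 * m, by ring⟩ ⟨m, by ring⟩
  · obtain ⟨m, rfl⟩ : ∃ m, n = 4 * m + 2 := ⟨n / 4, by omega⟩
    have : (4 * m + 2) ^ 2 + (4 * m + 2) = 2 * ((2 * m + 1) * (4 * m + 3)) := by ring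
    rw [this, Nat.mul_div_cancel_left _ (by norm_num)]
    exact Odd.mul ⟨m, by ring⟩ ⟨2 * m + 1, by ring⟩

/-- If `n x² = y² + z²` in integers with `x ≠ 0`, then `n` is a sum of two squares (a prime
`q ≡ 3 (mod 4)` divides `y² + z²` to an even power, Fermat–Euler; so it divides `n` to an even
power). (Lander 1983, §2.1, p. 43 and Problem 2.1.) [cite: Lander1983, §2.1] -/
theorem eq_sq_add_sq_of_mul_sq_eq {n : ℕ} {x y z : ℤ} (hx : x ≠ 0)
    (h : (n : ℤ) * x ^ 2 = y ^ 2 + z ^ 2) : ∃ a b : ℕ, n = a ^ 2 + b ^ 2 := by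
  rcases Nat.eq_zero_or_pos n with rfl | hn0
  · exact ⟨0, 0, by simp⟩
  have keyN : n * x.natAbs ^ 2 = y.natAbs ^ 2 + z.natAbs ^ 2 := by
    apply Int.natCast_inj.mp
    push_cast
    simp only [sq_abs]
    exact h
  have hxN : x.natAbs ≠ 0 := Int.natAbs_ne_zero.mpr hx
  have hsum := Nat.eq_sq_add_sq_iff.mp ⟨_, _, keyN⟩
  refine Nat.eq_sq_add_sq_iff.mpr fun q hq hq3 => ?_
  have hqprime : q.Prime := Nat.prime_of_mem_primeFactors hq
  haveI := Fact.mk hqprime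
  have hne : n * x.natAbs ^ 2 ≠ 0 := mul_ne_zero hn0.ne' (pow_ne_zero _ hxN)
  have hq' : q ∈ (n * x.natAbs ^ 2).primeFactors :=
    Nat.mem_primeFactors.mpr
      ⟨hqprime, dvd_mul_of_dvd_left (Nat.dvd_of_mem_primeFactors hq) _, hne⟩
  have heven := hsum q hq' hq3
  rw [padicValNat.mul hn0.ne' (pow_ne_zero _ hxN), padicValNat.pow] at heven
  exact (Nat.even_add.mp heven).mpr (even_two_mul _)

/-- **Bruck–Ryser theorem for projective planes** (from the named fact `BruckRyserChowla`): if a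
finite projective plane of order `n` exists and `n ≡ 1` or `2 (mod 4)`, then `n` is a sum of two
integer squares. (Bruck–Ryser 1949, Thm. 1, stated there as: no plane if moreover the squarefree
part of `n` has a prime factor `≡ 3 (mod 4)`; Lander 1983, §2.1, p. 43: for `λ = 1`,
`v = n² + n + 1`, the equation becomes `n x² = y² + z²`.) [cite: BruckRyser1949, Thm 1] -/
theorem order_eq_sq_add_sq_of_bruckRyserChowla (hBRC : BruckRyserChowla)
    (h4 : ProjectivePlane.order P L % 4 = 1 ∨ ProjectivePlane.order P L % 4 = 2) :
    ∃ a b : ℕ, ProjectivePlane.order P L = a ^ 2 + b ^ 2 := by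
  set n := ProjectivePlane.order P L with hn
  have hodd : Odd (n ^ 2 + n + 1) := by
    have : Even (n ^ 2 + n) := by
      rw [sq, ← Nat.mul_succ]
      exact Nat.even_mul_succ_self n
    exact this.add_one
  obtain ⟨x, y, z, hne, heq⟩ :=
    (SymmetricDesign.ofProjectivePlane P L).bruckRyserChowla hBRC hodd
  rw [neg_one_pow_planes h4] at heq
  push_cast at heq
  have key : (n : ℤ) * x ^ 2 = y ^ 2 + z ^ 2 := by linear_combination heq
  have hx : x ≠ 0 := by
    rintro rfl
    have h0 : y ^ 2 + z ^ 2 = 0 := by linear_combination -key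
    have hy : y = 0 := by nlinarith [sq_nonneg y, sq_nonneg z]
    have hz : z = 0 := by nlinarith [sq_nonneg y, sq_nonneg z]
    simp [hy, hz] at hne
  exact eq_sq_add_sq_of_mul_sq_eq hx key

/-- `6` is not a sum of two squares. [folklore] -/
theorem six_ne_sq_add_sq : ¬ ∃ a b : ℕ, 6 = a ^ 2 + b ^ 2 := by
  rintro ⟨a, b, h⟩
  have ha : a ≤ 2 := by nlinarith
  have hb : b ≤ 2 := by nlinarith
  interval_cases a <;> interval_cases b <;> omega

/-- **There is no projective plane of order 6** (given the Bruck–Ryser–Chowla fact): `6 ≡ 2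
(mod 4)` is not a sum of two squares. (Bruck–Ryser 1949, Thm. 1 and the remark after it,
`N = 2p`, `p ≡ 3 (mod 4)`; Lander 1983, §2.1: "projective planes of order 6, 14, 21, 22, 30 or
33 therefore cannot exist".) [cite: BruckRyser1949, Thm 1] -/
theorem order_ne_six_of_bruckRyserChowla (hBRC : BruckRyserChowla) :
    ProjectivePlane.order P L ≠ 6 := by
  intro h6
  have h := order_eq_sq_add_sq_of_bruckRyserChowla P L hBRC (by omega)
  rw [h6] at h
  exact six_ne_sq_add_sq h

end ProjectivePlane

/-! ### Proof of the Bruck–Ryser–Chowla theorem (Ryser 1963, Ch. 8, Thm. 3.1)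

The named fact `BruckRyserChowla` is discharged below (`BruckRyserChowla_holds`). The proof is
Ryser's: (3.19)/(3.21) the incidence matrix `A` exhibits the rational congruence
`B = (k-λ)I + λJ ≅ I`, read as the identity of quadratic forms
`∑_B (∑_p A_{pB} x_p)² = (k-λ)∑ x_p² + λ(∑ x_p)²`; (3.12)–(3.16) Lagrange's four-square theorem and
the `4 × 4` matrix `H` give `(k-λ) I_m ≅ I_m` for every `m ≡ 0 (mod 4)`; (3.22)–(3.28) for
`v ≡ 1 (mod 4)` and (3.29)–(3.35) for `v ≡ 3 (mod 4)` the free-variable descent `x_i = ± y_i`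
(one variable at a time, solving a rational linear equation whose relevant coefficient is made
`≠ 0` by the choice of sign) leaves `(k-λ)x_v² + λ(∑ x_i)² = y_v²`, resp.
`λ(∑ x_i)² + x_{v+1}² = (k-λ)y_{v+1}²`, at a rational point with the free variable equal to `1`;
clearing denominators gives the integral solution. The descent is phrased for linear forms on
`(Fin m → ℚ) × W` (`W` = the space of the free parameters) so that it can be proved once by
induction on `m` (`BruckRyserChowlaProof.descent`).
-/

namespace SymmetricDesign

variable {v k lam : ℕ}

/-- The incidence matrix as a rational congruence `B = Aᵀ I A`, in quadratic-form terms: for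
rational `x`, `∑_B (∑_p A_{pB} x_p)² = (k - λ) ∑_p x_p² + λ (∑_p x_p)²` (`xᵀ A Aᵀ x =
xᵀ((k-λ)I + λJ)x`). (Ryser 1963, Ch. 8, (3.19) and (3.21).) [cite: Ryser1963, Ch. 8 (3.21)] -/
theorem sum_sq_incidence_form (D : SymmetricDesign v k lam) (x : Fin v → ℚ) :
    ∑ B, (∑ p, (D.incidence p B : ℚ) * x p) ^ 2 =
      ((k : ℚ) - lam) * ∑ p, x p ^ 2 + lam * (∑ p, x p) ^ 2 := by
  have hentry : ∀ p p' : Fin v, ∑ B, (D.incidence p B : ℚ) * (D.incidence p' B : ℚ) =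
      if p = p' then (k : ℚ) else (lam : ℚ) := by
    intro p p'
    have h := congrArg (Int.cast : ℤ → ℚ) (D.sum_incidence_mul_incidence p p')
    push_cast at h
    rw [h]
  calc ∑ B, (∑ p, (D.incidence p B : ℚ) * x p) ^ 2
      = ∑ B, ∑ p, ∑ p', ((D.incidence p B : ℚ) * x p) * ((D.incidence p' B : ℚ) * x p') := by
        refine Finset.sum_congr rfl fun B _ => ?_
        rw [sq, Finset.sum_mul_sum]
    _ = ∑ p, ∑ p', x p * x p' * ∑ B, (D.incidence p B : ℚ) * (D.incidence p' B : ℚ) := by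
        rw [Finset.sum_comm]
        refine Finset.sum_congr rfl fun p _ => ?_
        rw [Finset.sum_comm]
        refine Finset.sum_congr rfl fun p' _ => ?_
        rw [Finset.mul_sum]
        refine Finset.sum_congr rfl fun B _ => ?_
        ring
    _ = ∑ p, ∑ p', (lam * (x p * x p') +
          if p = p' then ((k : ℚ) - lam) * (x p * x p') else 0) := by
        refine Finset.sum_congr rfl fun p _ => Finset.sum_congr rfl fun p' _ => ?_
        rw [hentry]
        split_ifs <;> ring
    _ = ((k : ℚ) - lam) * ∑ p, x p ^ 2 + lam * (∑ p, x p) ^ 2 := by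
        simp_rw [Finset.sum_add_distrib, Finset.sum_ite_eq, if_pos (Finset.mem_univ _),
          ← Finset.mul_sum]
        rw [sq (∑ p, x p), Finset.sum_mul_sum, Finset.mul_sum]
        simp_rw [Finset.mul_sum, sq]
        ring

end SymmetricDesign

namespace BruckRyserChowlaProof

variable {W : Type*} [AddCommGroup W] [Module ℚ W]

/-- One step of the free-variable descent (Ryser 1963, Ch. 8, proof of Thm. 3.1, (3.24)–(3.25)):
a rational linear form `y₀` in `m + 1` variables `z₀, …, z_m` (and parameters `w`) can be made to
satisfy `y₀² = z₀²` by solving `y₀ = z₀` for `z₀` when the coefficient of `z₀` in `y₀` is `≠ 1`,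
and `y₀ = -z₀` when it is `1`; either way `z₀` becomes a linear form `ψ` in the other variables.
[cite: Ryser1963, Ch. 8 Thm. 3.1] -/
theorem exists_subst (m : ℕ) (y₀ : ((Fin (m + 1) → ℚ) × W) →ₗ[ℚ] ℚ) :
    ∃ ψ : ((Fin m → ℚ) × W) →ₗ[ℚ] ℚ, ∀ e, (y₀ (Matrix.vecCons (ψ e) e.1, e.2)) ^ 2 = (ψ e) ^ 2 := by
  -- the substitution `(z', w) ↦ (0 :: z', w)` as a linear map, and the coefficient `c` of `z₀`
  obtain ⟨L₀, hL₀⟩ : ∃ L₀ : ((Fin m → ℚ) × W) →ₗ[ℚ] ((Fin (m + 1) → ℚ) × W),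
      ∀ e, L₀ e = (Matrix.vecCons 0 e.1, e.2) :=
    ⟨((0 : ((Fin m → ℚ) × W) →ₗ[ℚ] ℚ).vecCons (LinearMap.fst ℚ _ _)).prod (LinearMap.snd ℚ _ _),
      fun e => rfl⟩
  set c : ℚ := y₀ (Matrix.vecCons 1 0, 0) with hc_def
  set ℓ : ((Fin m → ℚ) × W) →ₗ[ℚ] ℚ := y₀ ∘ₗ L₀ with hℓ_def
  have key : ∀ (t : ℚ) (e : (Fin m → ℚ) × W),
      y₀ (Matrix.vecCons t e.1, e.2) = c * t + ℓ e := by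
    intro t e
    have hsplit : ((Matrix.vecCons t e.1, e.2) : (Fin (m + 1) → ℚ) × W) =
        t • ((Matrix.vecCons 1 0, (0 : W)) : (Fin (m + 1) → ℚ) × W) +
          (Matrix.vecCons 0 e.1, e.2) := by
      refine Prod.ext ?_ ?_
      · funext i
        refine Fin.cases ?_ (fun j => ?_) i <;> simp
      · simp
    rw [hsplit, map_add, map_smul, hℓ_def, LinearMap.comp_apply, hL₀]
    simp [hc_def, mul_comm]
  by_cases hc : c = 1
  · refine ⟨-(1 / 2 : ℚ) • ℓ, fun e => ?_⟩
    rw [key, hc]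
    simp only [LinearMap.smul_apply, smul_eq_mul]
    ring
  · refine ⟨(1 / (1 - c)) • ℓ, fun e => ?_⟩
    have h1c : (1 - c) ≠ 0 := sub_ne_zero.mpr (Ne.symm hc)
    rw [key]
    simp only [LinearMap.smul_apply, smul_eq_mul]
    field_simp
    ring

/-- **The free-variable descent** (Ryser 1963, Ch. 8, proof of Thm. 3.1, (3.24)–(3.28)): if
rational linear forms `y_1, …, y_m` in the variables `z_1, …, z_m` and parameters `w` satisfy an
identity `∑ yᵢ² + A = ∑ zᵢ² + B`, then the variables `zᵢ` can be chosen as linear functions of the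
parameters so that `A = B` (choose `z_1 = ± y_1`, then `z_2 = ± y_2`, …).
[cite: Ryser1963, Ch. 8 Thm. 3.1] -/
theorem descent : ∀ (m : ℕ) (y : Fin m → (((Fin m → ℚ) × W) →ₗ[ℚ] ℚ))
    (A B : ((Fin m → ℚ) × W) → ℚ),
    (∀ e, ∑ i, (y i e) ^ 2 + A e = ∑ i, (e.1 i) ^ 2 + B e) →
    ∃ φ : W →ₗ[ℚ] (Fin m → ℚ), ∀ w, A (φ w, w) = B (φ w, w)
  | 0, y, A, B, h => ⟨0, fun w => by simpa using h (0, w)⟩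
  | m + 1, y, A, B, h => by
    obtain ⟨ψ, hψ⟩ := exists_subst m (y 0)
    -- the substitution `(z', w) ↦ (ψ(z', w) :: z', w)` as a linear map
    obtain ⟨L, hL⟩ : ∃ L : ((Fin m → ℚ) × W) →ₗ[ℚ] ((Fin (m + 1) → ℚ) × W),
        ∀ e, L e = (Matrix.vecCons (ψ e) e.1, e.2) :=
      ⟨(ψ.vecCons (LinearMap.fst ℚ _ _)).prod (LinearMap.snd ℚ _ _), fun e => rfl⟩
    obtain ⟨φ', hφ'⟩ := descent m (fun i => y i.succ ∘ₗ L) (A ∘ L) (B ∘ L) (by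
        intro e
        have h1 := h (L e)
        rw [Fin.sum_univ_succ, Fin.sum_univ_succ (fun i => ((L e).1 i) ^ 2), hL, hψ e] at h1
        simp only [Matrix.cons_val_zero, Matrix.cons_val_succ, Function.comp_apply,
          LinearMap.comp_apply, hL] at h1 ⊢
        linarith)
    refine ⟨LinearMap.fst ℚ _ _ ∘ₗ L ∘ₗ (φ'.prod LinearMap.id), fun w => ?_⟩
    have h2 := hφ' w
    simp only [Function.comp_apply] at h2
    have heq : ((LinearMap.fst ℚ _ _ ∘ₗ L ∘ₗ (φ'.prod LinearMap.id)) w, w) = L (φ' w, w) := by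
      refine Prod.ext rfl ?_
      simp [hL]
    rw [heq]
    exact h2

/-- `n I₄` and `I₄` are congruent over `ℚ` for `n ≠ 0` a sum of four rational squares
`a² + b² + c² + d²`: with Ryser's matrix `H` (rows as in Euler's four-square identity,
`|Hz|² = n|z|²`) the matrix `G = n⁻¹ H` satisfies `n |Gz|² = |z|²`. (Ryser 1963, Ch. 8,
(3.12)–(3.15).) [cite: Ryser1963, Ch. 8 (3.15)] -/
theorem exists_matrix_four {n : ℚ} (hn : n ≠ 0)
    (h : ∃ a b c d : ℚ, a ^ 2 + b ^ 2 + c ^ 2 + d ^ 2 = n) :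
    ∃ G : Matrix (Fin 4) (Fin 4) ℚ, ∀ z : Fin 4 → ℚ,
      n * ∑ i, (∑ j, G i j * z j) ^ 2 = ∑ i, z i ^ 2 := by
  obtain ⟨a, b, c, d, habcd⟩ := h
  -- Ryser's `H` of (3.13) (up to the order of rows): `|Hz|² = (a²+b²+c²+d²)|z|²` is Euler's identity
  set H : Matrix (Fin 4) (Fin 4) ℚ := !![a, -b, -c, -d; b, a, -d, c; c, d, a, -b; d, -c, b, a]
    with hH
  have key : ∀ z : Fin 4 → ℚ, ∑ i, (∑ j, H i j * z j) ^ 2 = n * ∑ i, z i ^ 2 := by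
    intro z
    rw [← habcd]
    simp [hH, Fin.sum_univ_four]
    ring
  refine ⟨(1 / n) • H, fun z => ?_⟩
  have hrow : ∀ i, ∑ j, ((1 / n) • H) i j * z j = (1 / n) * ∑ j, H i j * z j := by
    intro i
    rw [Finset.mul_sum]
    refine Finset.sum_congr rfl fun j _ => ?_
    simp only [Matrix.smul_apply, smul_eq_mul]
    ring
  simp_rw [hrow, mul_pow, ← Finset.mul_sum, key z]
  field_simp

/-- `n I_m` and `I_m` are congruent over `ℚ` for every `m ≡ 0 (mod 4)` (direct sum of `m / 4`
copies of the `4 × 4` congruence): there is an `m × m` rational matrix `M` with `n |Mz|² = |z|²`.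
(Ryser 1963, Ch. 8, (3.11) and (3.16).) [cite: Ryser1963, Ch. 8 (3.16)] -/
theorem exists_matrix_of_four_dvd {n : ℚ} (hn : n ≠ 0)
    (h : ∃ a b c d : ℚ, a ^ 2 + b ^ 2 + c ^ 2 + d ^ 2 = n) {m : ℕ} (hm : 4 ∣ m) :
    ∃ M : Matrix (Fin m) (Fin m) ℚ, ∀ z : Fin m → ℚ,
      n * ∑ i, (∑ j, M i j * z j) ^ 2 = ∑ i, z i ^ 2 := by
  classical
  obtain ⟨q, rfl⟩ := hm
  obtain ⟨G, hG⟩ := exists_matrix_four hn h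
  let ρ : Fin (4 * q) ≃ Fin q × Fin 4 := Fintype.equivOfCardEq (by simp [mul_comm])
  let Γ : (Fin q × Fin 4) → (Fin q × Fin 4) → ℚ :=
    fun p p' => if p.1 = p'.1 then G p.2 p'.2 else 0
  refine ⟨Matrix.of fun i j => Γ (ρ i) (ρ j), fun z => ?_⟩
  have hrow : ∀ i, ∑ j, (Matrix.of fun i j => Γ (ρ i) (ρ j)) i j * z j =
      ∑ b, G (ρ i).2 b * z (ρ.symm ((ρ i).1, b)) := by
    intro i
    simp only [Matrix.of_apply]
    rw [← ρ.symm.sum_comp (fun j => Γ (ρ i) (ρ j) * z j)]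
    simp only [Equiv.apply_symm_apply, Γ]
    rw [Fintype.sum_prod_type]
    rw [Finset.sum_eq_single (ρ i).1]
    · simp
    · intro a _ ha
      simp [Ne.symm ha]
    · simp
  simp_rw [hrow]
  rw [← ρ.symm.sum_comp (fun i => (∑ b, G (ρ i).2 b * z (ρ.symm ((ρ i).1, b))) ^ 2)]
  simp only [Equiv.apply_symm_apply]
  rw [Fintype.sum_prod_type, Finset.mul_sum]
  simp only
  rw [← ρ.symm.sum_comp (fun i => z i ^ 2), Fintype.sum_prod_type]
  refine Finset.sum_congr rfl fun a _ => ?_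
  exact hG (fun b => z (ρ.symm (a, b)))

/-- **Case `v ≡ 1 (mod 4)`** of the descent (Ryser 1963, Ch. 8, proof of Thm. 3.1,
(3.22)–(3.28)), in abstract form: if rational linear forms `Y_0, …, Y_m` in `m + 1` variables
(`4 ∣ m`) satisfy `∑ Y_j(x)² = n ∑ x_j² + λ (∑ x_j)²` with `n ≠ 0` a sum of four squares, then
`n X² + λ Y² = Z²` has a rational solution with `X ≠ 0` (indeed `X = 1`).
[cite: Ryser1963, Ch. 8 Thm. 3.1] -/
theorem exists_rat_of_forms_one {m : ℕ} {n lam : ℚ} (hn : n ≠ 0)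
    (h4 : ∃ a b c d : ℚ, a ^ 2 + b ^ 2 + c ^ 2 + d ^ 2 = n) (hm : 4 ∣ m)
    (Y : Fin (m + 1) → ((Fin (m + 1) → ℚ) →ₗ[ℚ] ℚ))
    (hY : ∀ x, ∑ j, (Y j x) ^ 2 = n * ∑ j, x j ^ 2 + lam * (∑ j, x j) ^ 2) :
    ∃ X Y' Z : ℚ, X ≠ 0 ∧ n * X ^ 2 + lam * Y' ^ 2 = Z ^ 2 := by
  obtain ⟨M, hM⟩ := exists_matrix_of_four_dvd hn h4 hm
  -- variables: `e = (z, w)`, `x = (w, M z)` so that `n ∑_{j ≥ 1} x_j² = ∑ z_i²`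
  let xmap : ((Fin m → ℚ) × ℚ) →ₗ[ℚ] (Fin (m + 1) → ℚ) :=
    LinearMap.pi (Fin.cases (LinearMap.snd ℚ (Fin m → ℚ) ℚ)
      (fun i => (LinearMap.proj i ∘ₗ Matrix.mulVecLin M) ∘ₗ LinearMap.fst ℚ (Fin m → ℚ) ℚ))
  have hx0 : ∀ e, xmap e 0 = e.2 := by
    intro e
    simp [xmap]
  have hxs : ∀ e (i : Fin m), xmap e i.succ = ∑ j, M i j * e.1 j := by
    intro e i
    simp [xmap, Matrix.mulVec, dotProduct]
  obtain ⟨φ, hφ⟩ := descent m (fun i => Y i.succ ∘ₗ xmap) (fun e => (Y 0 (xmap e)) ^ 2)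
    (fun e => n * e.2 ^ 2 + lam * (∑ j, xmap e j) ^ 2) (by
      intro e
      have h1 := hY (xmap e)
      have s1 : ∑ j, (Y j (xmap e)) ^ 2 =
          (Y 0 (xmap e)) ^ 2 + ∑ i : Fin m, (Y i.succ (xmap e)) ^ 2 :=
        Fin.sum_univ_succ _
      have s2 : ∑ j, xmap e j ^ 2 = e.2 ^ 2 + ∑ i, (∑ j, M i j * e.1 j) ^ 2 := by
        rw [Fin.sum_univ_succ, hx0]
        simp_rw [hxs]
      have h2 := hM e.1
      simp only [LinearMap.comp_apply]
      linear_combination h1 - s1 + n * s2 + h2)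
  refine ⟨1, ∑ j, xmap (φ 1, 1) j, Y 0 (xmap (φ 1, 1)), one_ne_zero, ?_⟩
  have h3 := hφ 1
  simp only at h3
  linear_combination -h3

/-- **Case `v ≡ 3 (mod 4)`** of the descent (Ryser 1963, Ch. 8, proof of Thm. 3.1,
(3.29)–(3.35)), in abstract form: if rational linear forms `Y_1, …, Y_v` in `v` variables
(`4 ∣ v + 1`) satisfy `∑ Y_j(x)² = n ∑ x_j² + λ (∑ x_j)²` with `n ≠ 0` a sum of four squares, then
`n X² - λ Y² = Z²` has a rational solution with `Z ≠ 0` (indeed `Z = 1`).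
[cite: Ryser1963, Ch. 8 Thm. 3.1] -/
theorem exists_rat_of_forms_three {v : ℕ} {n lam : ℚ} (hn : n ≠ 0)
    (h4 : ∃ a b c d : ℚ, a ^ 2 + b ^ 2 + c ^ 2 + d ^ 2 = n) (hv : 4 ∣ v + 1)
    (Y : Fin v → ((Fin v → ℚ) →ₗ[ℚ] ℚ))
    (hY : ∀ x, ∑ j, (Y j x) ^ 2 = n * ∑ j, x j ^ 2 + lam * (∑ j, x j) ^ 2) :
    ∃ X Y' Z : ℚ, Z ≠ 0 ∧ n * X ^ 2 - lam * Y' ^ 2 = Z ^ 2 := by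
  obtain ⟨M, hM⟩ := exists_matrix_of_four_dvd hn h4 hv
  -- variables: `e = (z', w)`, the `(v+1)`-vector `z = (w, z')`, `x⁺ = M z`; the design variables
  -- are `x_j = x⁺_{j+1}`, the extra one is `u = x⁺_0`, so that `n (u² + ∑ x_j²) = w² + ∑ z'_j²`.
  let zvec : ((Fin v → ℚ) × ℚ) →ₗ[ℚ] (Fin (v + 1) → ℚ) :=
    LinearMap.pi (Fin.cases (LinearMap.snd ℚ (Fin v → ℚ) ℚ)
      (fun j => LinearMap.proj j ∘ₗ LinearMap.fst ℚ (Fin v → ℚ) ℚ))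
  let full : ((Fin v → ℚ) × ℚ) →ₗ[ℚ] (Fin (v + 1) → ℚ) := Matrix.mulVecLin M ∘ₗ zvec
  let xmap : ((Fin v → ℚ) × ℚ) →ₗ[ℚ] (Fin v → ℚ) :=
    LinearMap.pi (fun j => LinearMap.proj j.succ ∘ₗ full)
  have hz0 : ∀ e, zvec e 0 = e.2 := by
    intro e
    simp [zvec]
  have hzs : ∀ e (j : Fin v), zvec e j.succ = e.1 j := by
    intro e j
    simp [zvec]
  have hfull : ∀ e i, full e i = ∑ j, M i j * zvec e j := by
    intro e i
    simp [full, Matrix.mulVec, dotProduct]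
  have hxmap : ∀ e j, xmap e j = full e j.succ := by
    intro e j
    simp [xmap]
  obtain ⟨φ, hφ⟩ := descent v (fun j => Y j ∘ₗ xmap) (fun e => n * (full e 0) ^ 2)
    (fun e => e.2 ^ 2 + lam * (∑ j, xmap e j) ^ 2) (by
      intro e
      have h1 := hY (xmap e)
      have h2 := hM (zvec e)
      have s2 : ∑ i, zvec e i ^ 2 = e.2 ^ 2 + ∑ j, e.1 j ^ 2 := by
        rw [Fin.sum_univ_succ, hz0]
        simp_rw [hzs]
      have s3 : ∑ i, (∑ j, M i j * zvec e j) ^ 2 = (full e 0) ^ 2 + ∑ j, (xmap e j) ^ 2 := by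
        rw [Fin.sum_univ_succ]
        simp_rw [hxmap, hfull]
      simp only [LinearMap.comp_apply]
      linear_combination h1 + h2 - n * s3 + s2)
  refine ⟨full (φ 1, 1) 0, ∑ j, xmap (φ 1, 1) j, 1, one_ne_zero, ?_⟩
  have h3 := hφ 1
  simp only at h3
  linear_combination h3

/-- Clearing denominators: a rational solution of `n x² + s y² = z²` gives an integral one, with
`X ≠ 0` if `x ≠ 0` and `Z ≠ 0` if `z ≠ 0`. (Ryser 1963, Ch. 8, proof of Thm. 3.1, last step;
Lander 1983, proof of Thm. 2.1: "multiplying through by a common denominator".) [folklore] -/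
private theorem exists_int_of_rat {n s : ℤ} {x y z : ℚ} (h : (n : ℚ) * x ^ 2 + s * y ^ 2 = z ^ 2) :
    ∃ X Y Z : ℤ, (x ≠ 0 → X ≠ 0) ∧ (z ≠ 0 → Z ≠ 0) ∧ n * X ^ 2 + s * Y ^ 2 = Z ^ 2 := by
  refine ⟨x.num * (y.den * z.den), y.num * (x.den * z.den), z.num * (x.den * y.den),
    fun hx => ?_, fun hz => ?_, ?_⟩
  · exact mul_ne_zero (Rat.num_ne_zero.mpr hx)
      (mul_ne_zero (Int.natCast_ne_zero.mpr y.den_nz) (Int.natCast_ne_zero.mpr z.den_nz))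
  · exact mul_ne_zero (Rat.num_ne_zero.mpr hz)
      (mul_ne_zero (Int.natCast_ne_zero.mpr x.den_nz) (Int.natCast_ne_zero.mpr y.den_nz))
  · have hx : ((x.num : ℤ) : ℚ) = x * x.den := (Rat.mul_den_eq_num x).symm
    have hy : ((y.num : ℤ) : ℚ) = y * y.den := (Rat.mul_den_eq_num y).symm
    have hz : ((z.num : ℤ) : ℚ) = z * z.den := (Rat.mul_den_eq_num z).symm
    have key : ((n * (x.num * (y.den * z.den)) ^ 2 + s * (y.num * (x.den * z.den)) ^ 2 : ℤ) : ℚ) =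
        (((z.num * (x.den * y.den)) ^ 2 : ℤ) : ℚ) := by
      push_cast
      rw [hx, hy, hz]
      linear_combination ((x.den : ℚ) * y.den * z.den) ^ 2 * h
    exact_mod_cast key

end BruckRyserChowlaProof

open BruckRyserChowlaProof in
/-- **The Bruck–Ryser–Chowla theorem, PROVED** (discharging the named fact `BruckRyserChowla`):
if a symmetric `(v,k,λ)` design with `k > λ` exists and `v` is odd, then
`(k-λ) X² + (-1)^((v-1)/2) λ Y² = Z²` has a solution in integers not all zero. Proof as in
Ryser 1963, Ch. 8, Thm. 3.1: the incidence matrix gives `B = (k-λ)I + λJ ≅ I` over `ℚ`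
(`SymmetricDesign.sum_sq_incidence_form`); Lagrange's four-square theorem
(`Nat.sum_four_squares`) and the matrix `H` give `(k-λ) I₄ ≅ I₄`, hence `(k-λ) I_m ≅ I_m` for
`4 ∣ m` (`exists_matrix_of_four_dvd`); the free-variable descent `x_i = ± y_i` (`descent`) leaves
`(k-λ) x_v² + λ(∑ x_i)² = y_v²` for `v ≡ 1 (mod 4)` and `λ(∑ x_i)² + x_{v+1}² = (k-λ) y_{v+1}²`
for `v ≡ 3 (mod 4)` at a rational point with the free variable equal to `1`; clearing
denominators finishes. (Ryser 1963, Ch. 8, Thm. 3.1; Lander 1983, Thm. 2.1; Bruck–Ryser 1949,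
Chowla–Ryser 1950.) [cite: Ryser1963, Ch. 8 Thm. 3.1] -/
theorem BruckRyserChowla_holds : BruckRyserChowla := by
  intro v k lam D hkl hodd
  -- the order `n = k - λ > 0`, as a rational number, is a sum of four squares
  set nQ : ℚ := (k : ℚ) - lam with hnQ_def
  have hnQ : nQ = ((k - lam : ℕ) : ℚ) := by
    rw [hnQ_def, Nat.cast_sub hkl.le]
  have hnQ0 : nQ ≠ 0 := by
    rw [hnQ]
    exact_mod_cast (Nat.sub_pos_of_lt hkl).ne'
  have h4 : ∃ a b c d : ℚ, a ^ 2 + b ^ 2 + c ^ 2 + d ^ 2 = nQ := by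
    obtain ⟨a, b, c, d, h⟩ := Nat.sum_four_squares (k - lam)
    exact ⟨a, b, c, d, by rw [hnQ]; exact_mod_cast h⟩
  -- the linear forms `Y_B(x) = ∑_p A_{pB} x_p` of the incidence matrix
  let Yf : Fin v → ((Fin v → ℚ) →ₗ[ℚ] ℚ) :=
    fun B => ∑ p, (D.incidence p B : ℚ) • LinearMap.proj p
  have hYf : ∀ B x, Yf B x = ∑ p, (D.incidence p B : ℚ) * x p := by
    intro B x
    simp [Yf]
  have hY : ∀ x : Fin v → ℚ,
      ∑ j, (Yf j x) ^ 2 = nQ * ∑ j, x j ^ 2 + lam * (∑ j, x j) ^ 2 := by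
    intro x
    simp_rw [hYf]
    exact D.sum_sq_incidence_form x
  -- `v` odd: `v = 4q + 1` or `v = 4q + 3`
  obtain ⟨t, ht⟩ := hodd
  rcases Nat.even_or_odd t with ⟨q, hq⟩ | ⟨q, hq⟩
  · -- `v ≡ 1 (mod 4)`
    obtain rfl : v = 4 * q + 1 := by omega
    obtain ⟨X, Y', Z, hX, hXYZ⟩ :=
      exists_rat_of_forms_one (m := 4 * q) hnQ0 h4 ⟨q, rfl⟩ Yf hY
    have hsign : (-1 : ℤ) ^ ((4 * q + 1 - 1) / 2) = 1 := by
      rw [show (4 * q + 1 - 1) / 2 = 2 * q by omega, pow_mul]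
      simp
    obtain ⟨Xi, Yi, Zi, hXi, -, hint⟩ :=
      exists_int_of_rat (n := (k : ℤ) - lam) (s := lam) (x := X) (y := Y') (z := Z)
        (by push_cast; rw [hnQ_def] at hXYZ; linear_combination hXYZ)
    exact ⟨Xi, Yi, Zi, Or.inl (hXi hX), by rw [hsign]; linear_combination hint⟩
  · -- `v ≡ 3 (mod 4)`
    obtain rfl : v = 4 * q + 3 := by omega
    obtain ⟨X, Y', Z, hZ, hXYZ⟩ :=
      exists_rat_of_forms_three (v := 4 * q + 3) hnQ0 h4 ⟨q + 1, by ring⟩ Yf hY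
    have hsign : (-1 : ℤ) ^ ((4 * q + 3 - 1) / 2) = -1 := by
      rw [show (4 * q + 3 - 1) / 2 = 2 * q + 1 by omega, pow_succ, pow_mul]
      simp
    obtain ⟨Xi, Yi, Zi, -, hZi, hint⟩ :=
      exists_int_of_rat (n := (k : ℤ) - lam) (s := -lam) (x := X) (y := Y') (z := Z)
        (by push_cast; rw [hnQ_def] at hXYZ; linear_combination hXYZ)
    exact ⟨Xi, Yi, Zi, Or.inr (Or.inr (hZi hZ)), by rw [hsign]; linear_combination hint⟩


/-! ### Consequences, now unconditional -/

namespace SymmetricDesign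

variable {v k lam : ℕ}

/-- **Bruck–Ryser–Chowla for every `SymmetricDesign`, unconditionally**: if `v` is odd then
`(k-λ)X² + (-1)^((v-1)/2) λ Y² = Z²` has an integral solution `(X,Y,Z) ≠ (0,0,0)` (the degenerate
case `k ≤ λ` included). (Lander 1983, Thm. 2.1; Ryser 1963, Ch. 8, Thm. 3.1.)
[cite: Lander1983, Thm 2.1] -/
theorem exists_bruckRyserChowla (D : SymmetricDesign v k lam) (hodd : Odd v) :
    ∃ x y z : ℤ, (x ≠ 0 ∨ y ≠ 0 ∨ z ≠ 0) ∧
      ((k : ℤ) - lam) * x ^ 2 + (-1) ^ ((v - 1) / 2) * lam * y ^ 2 = z ^ 2 :=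
  D.bruckRyserChowla BruckRyserChowla_holds hodd

/-- Lander's remark after Thm. 2.1: the parity hypothesis may be dropped — for `v` even (`v > 0`)
the order `k - λ` is a square `r²` by Schützenberger's theorem and `(1, 0, r)` solves the
equation. (Lander 1983, Remark after Thm. 2.1, p. 42.) [cite: Lander1983, Thm 2.1] -/
theorem exists_bruckRyserChowla_of_pos (D : SymmetricDesign v k lam) (hv : 0 < v) :
    ∃ x y z : ℤ, (x ≠ 0 ∨ y ≠ 0 ∨ z ≠ 0) ∧
      ((k : ℤ) - lam) * x ^ 2 + (-1) ^ ((v - 1) / 2) * lam * y ^ 2 = z ^ 2 := by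
  rcases Nat.even_or_odd v with hev | hodd
  · obtain ⟨r, hr⟩ := D.isSquare_sub_of_even hev hv
    exact ⟨1, 0, r, by simp, by rw [hr]; ring⟩
  · exact D.exists_bruckRyserChowla hodd

end SymmetricDesign

section ProjectivePlane

open Configuration

variable (P L : Type*) [Membership P L] [Fintype P] [Fintype L]
  [Configuration.ProjectivePlane P L]

/-- **Bruck–Ryser theorem for projective planes, unconditionally**: if a finite projective plane
of order `n ≡ 1` or `2 (mod 4)` exists, then `n` is a sum of two integer squares.
(Bruck–Ryser 1949, Thm. 1; Lander 1983, §2.1, p. 43.) [cite: BruckRyser1949, Thm 1] -/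
theorem order_eq_sq_add_sq
    (h4 : ProjectivePlane.order P L % 4 = 1 ∨ ProjectivePlane.order P L % 4 = 2) :
    ∃ a b : ℕ, ProjectivePlane.order P L = a ^ 2 + b ^ 2 :=
  order_eq_sq_add_sq_of_bruckRyserChowla P L BruckRyserChowla_holds h4

/-- **There is no projective plane of order 6.** (Bruck–Ryser 1949, Thm. 1; Lander 1983, §2.1:
"projective planes of order 6, 14, 21, 22, 30 or 33 therefore cannot exist".)
[cite: BruckRyser1949, Thm 1] -/
theorem order_ne_six : ProjectivePlane.order P L ≠ 6 :=
  order_ne_six_of_bruckRyserChowla P L BruckRyserChowla_holds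

/-- `14` is not a sum of two squares. [folklore] -/
private theorem fourteen_ne_sq_add_sq : ¬ ∃ a b : ℕ, 14 = a ^ 2 + b ^ 2 := by
  rintro ⟨a, b, h⟩
  have ha : a ≤ 3 := by nlinarith
  have hb : b ≤ 3 := by nlinarith
  interval_cases a <;> interval_cases b <;> omega

/-- **There is no projective plane of order 14** (`14 ≡ 2 (mod 4)` is not a sum of two squares).
(Bruck–Ryser 1949, Thm. 1; Lander 1983, §2.1.) [cite: BruckRyser1949, Thm 1] -/
theorem order_ne_fourteen : ProjectivePlane.order P L ≠ 14 := by
  intro h14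
  have h := order_eq_sq_add_sq P L (by omega)
  rw [h14] at h
  exact fourteen_ne_sq_add_sq h

/-- `21` is not a sum of two squares. [folklore] -/
private theorem twentyone_ne_sq_add_sq : ¬ ∃ a b : ℕ, 21 = a ^ 2 + b ^ 2 := by
  rintro ⟨a, b, h⟩
  have ha : a ≤ 4 := by nlinarith
  have hb : b ≤ 4 := by nlinarith
  interval_cases a <;> interval_cases b <;> omega

/-- **There is no projective plane of order 21** (`21 ≡ 1 (mod 4)` is not a sum of two squares).
(Bruck–Ryser 1949, Thm. 1; Lander 1983, §2.1.) [cite: BruckRyser1949, Thm 1] -/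
theorem order_ne_twentyone : ProjectivePlane.order P L ≠ 21 := by
  intro h21
  have h := order_eq_sq_add_sq P L (by omega)
  rw [h21] at h
  exact twentyone_ne_sq_add_sq h

/-- `22` is not a sum of two squares. [folklore] -/
private theorem twentytwo_ne_sq_add_sq : ¬ ∃ a b : ℕ, 22 = a ^ 2 + b ^ 2 := by
  rintro ⟨a, b, h⟩
  have ha : a ≤ 4 := by nlinarith
  have hb : b ≤ 4 := by nlinarith
  interval_cases a <;> interval_cases b <;> omega

/-- **There is no projective plane of order 22** (`22 ≡ 2 (mod 4)` is not a sum of two squares).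
(Bruck–Ryser 1949, Thm. 1; Lander 1983, §2.1.) [cite: BruckRyser1949, Thm 1] -/
theorem order_ne_twentytwo : ProjectivePlane.order P L ≠ 22 := by
  intro h22
  have h := order_eq_sq_add_sq P L (by omega)
  rw [h22] at h
  exact twentytwo_ne_sq_add_sq h

end ProjectivePlane

end Literature.Combinatorics.Designs
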